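import Mathlib
import HarnessLib
import Literature.Analysis.FluidPDE.Tao2016AveragedNS.TaylorChainCertificate
import Summits.NavierStokesRegularity.NavierStokesRegularity.Theorems.TaylorModelRungThreeReadoutFlowVar

/-!
# Line `taylor-model` on crux K1b-DR (stmt-NavierStokesRegularity-23954) — stub G1 (`ChainEnclosureHolds`),
# helper 1: tools over an ARBITRARY flow package

First helper toward the registered stub `stub_chain : ChainEnclosureHolds` (skeleton v4 `a500375dfcc940c7`);
everything here is stated for an arbitrary `φ` with `IsFlowPackage cd φ` (clauses F0–F5 only), so the sibling
stubs G2–G4 can import it: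

* weighted-ball algebra: `inBall_mono`, `inBall_add`, `inBall_sub`, `inBall_neg`, `inBall_zero`,
  `inBall_trunc_iff`, `inBall_congr_window`;
* window support and LINEARITY of the certificate's variational polynomial: `wsupp_Wv`, `wsupp_Vap`,
  `Vap_add`, `Vap_smul`, `Vap_zero`, `Vap_sub`, `Vap_trunc` (from the `Wv` recursion clauses of `Chain` via the jet
  identification `toVec_varTable_eq_varJet` and `varJet_add/smul`);
* flows of a package only see the window of the datum on guarded horizons: `stAt_congr_window` (F1 + F2);
  off-window components vanish: `stAt_off_window`, `wsupp_stAt`.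

MODEL-lattice bookkeeping only (rung TL-M3); nothing here is a statement about the Navier–Stokes equations.
-/

noncomputable section

-- the sub-problem namespace repeats the summit name by design (D-0017)
set_option linter.dupNamespace false

namespace Summit.NavierStokesRegularity.NavierStokesRegularity.Theorems.TaylorModelReadout

open scoped BigOperators
open Set Finset Literature.Analysis.FluidPDE.TaoCascade Literature.Analysis.FluidPDE.TaoCascade.TaylorChain

variable {cd : CertData}

/-! ### Weighted-ball algebra -/

/-- Monotonicity of the weighted ball in the radius (weights positive). [folklore] -/
theorem inBall_mono {j : ℕ} (hω : ∀ k, 0 < cd.ω j k) {y : Fin 4 → ℤ → ℝ} {N N' : ℝ} (h : cd.InBall j y N)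
    (hle : N ≤ N') : cd.InBall j y N' := fun i k h1 h2 =>
  (h i k h1 h2).trans (mul_le_mul_of_nonneg_right hle (hω k).le)

/-- Sums of weighted balls. [folklore] -/
theorem inBall_add {j : ℕ} {y y' : Fin 4 → ℤ → ℝ} {N N' : ℝ} (h : cd.InBall j y N) (h' : cd.InBall j y' N') :
    cd.InBall j (y + y') (N + N') := fun i k h1 h2 => by
  rw [Pi.add_apply, Pi.add_apply, add_mul]
  exact (abs_add_le _ _).trans (add_le_add (h i k h1 h2) (h' i k h1 h2))

/-- Negation preserves weighted balls. [folklore] -/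
theorem inBall_neg {j : ℕ} {y : Fin 4 → ℤ → ℝ} {N : ℝ} (h : cd.InBall j y N) : cd.InBall j (-y) N :=
  fun i k h1 h2 => by rw [Pi.neg_apply, Pi.neg_apply, abs_neg]; exact h i k h1 h2

/-- Differences of weighted balls. [folklore] -/
theorem inBall_sub {j : ℕ} {y y' : Fin 4 → ℤ → ℝ} {N N' : ℝ} (h : cd.InBall j y N) (h' : cd.InBall j y' N') :
    cd.InBall j (y - y') (N + N') := by
  rw [sub_eq_add_neg]; exact inBall_add h (inBall_neg h')

/-- `0` is in the ball of radius `0`. [folklore] -/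
theorem inBall_zero (j : ℕ) : cd.InBall j 0 0 := fun i k _ _ => by simp

/-- The weighted ball only sees the window. [folklore] -/
theorem inBall_trunc_iff {j : ℕ} {y : Fin 4 → ℤ → ℝ} {N : ℝ} : cd.InBall j (trunc cd y) N ↔ cd.InBall j y N := by
  constructor
  · intro h i k h1 h2
    have := h i k h1 h2
    simpa [trunc, h1, h2] using this
  · intro h i k h1 h2
    simpa [trunc, h1, h2] using h i k h1 h2

/-- States agreeing on the window lie in the same weighted balls. [folklore] -/
theorem inBall_congr_window {j : ℕ} {y y' : Fin 4 → ℤ → ℝ} {N : ℝ}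
    (hyy : ∀ i k, -cd.Kb ≤ k → k ≤ cd.Ka → y i k = y' i k) (h : cd.InBall j y N) : cd.InBall j y' N :=
  fun i k h1 h2 => by rw [← hyy i k h1 h2]; exact h i k h1 h2

/-! ### Window support and linearity of the variational polynomial -/

section Vap

variable {j s : ℕ}
  (hW0 : ∀ (v : Fin 4 → ℤ → ℝ) i k, cd.Wv j s 0 v i k = if -cd.Kb ≤ k ∧ k ≤ cd.Ka then v i k else 0)
  (hWrec : ∀ n, n < cd.pdeg → ∀ (v : Fin 4 → ℤ → ℝ) i k, ((n : ℝ) + 1) * cd.Wv j s (n + 1) v i k =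
    ∑ m' ∈ Finset.range (n + 1), (cd.Qb (cd.P j s m') (cd.Wv j s (n - m') v) i k +
      cd.Qb (cd.Wv j s (n - m') v) (cd.P j s m') i k))
include hW0 hWrec

/-- The variational jets of the certificate are window-supported (the recursion's right-hand side is, being
built from `Qb`). [folklore] -/
theorem wsupp_Wv : ∀ n, n ≤ cd.pdeg → ∀ v : Fin 4 → ℤ → ℝ, cd.Wsupp (cd.Wv j s n v) := by
  intro n
  induction n with
  | zero => intro _ v i k hk; rw [hW0]; simp [hk]
  | succ n _ =>
    intro hn v i k hk
    have h := hWrec n (Nat.lt_of_succ_le hn) v i k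
    have hz : ∑ m' ∈ Finset.range (n + 1), (cd.Qb (cd.P j s m') (cd.Wv j s (n - m') v) i k +
        cd.Qb (cd.Wv j s (n - m') v) (cd.P j s m') i k) = 0 := by
      refine Finset.sum_eq_zero fun m' _ => ?_
      rw [wsupp_Qb cd _ _ i k hk, wsupp_Qb cd _ _ i k hk, add_zero]
    rw [hz] at h
    have hk' : ((n : ℝ) + 1) ≠ 0 := by positivity
    exact (mul_eq_zero.1 h).resolve_left hk'

/-- The variational polynomial `Vap` is window-supported. [folklore] -/
theorem wsupp_Vap (u : ℝ) (v : Fin 4 → ℤ → ℝ) : cd.Wsupp (cd.Vap j s u v) := by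
  intro i k hk
  simp only [CertData.Vap]
  refine Finset.sum_eq_zero fun n hn => ?_
  rw [wsupp_Wv hW0 hWrec n (Nat.lt_succ_iff.1 (Finset.mem_range.1 hn)) v i k hk, zero_mul]

variable (hP : ∀ n, n ≤ cd.pdeg → toVec cd (cd.P j s n) = taylorJet (Qw cd) (toVec cd (cd.x j s)) n)
include hP

/-- Jet identification for `Wv` (from the recursion clauses). [folklore] -/
theorem toVec_Wv (v : Fin 4 → ℤ → ℝ) : ∀ n, n ≤ cd.pdeg →
    toVec cd (cd.Wv j s n v) = varJet (Qw cd) (toVec cd (cd.x j s)) (toVec cd v) n :=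
  toVec_varTable_eq_varJet (W := fun n => cd.Wv j s n v) hP (hW0 v) (fun n hn i k => hWrec n hn v i k)

/-- `Vap` is additive in the vector argument. [folklore] -/
theorem Vap_add (u : ℝ) (v v' : Fin 4 → ℤ → ℝ) : cd.Vap j s u (v + v') = cd.Vap j s u v + cd.Vap j s u v' := by
  refine eq_of_toVec_eq cd (wsupp_Vap hW0 hWrec u _) ?_ ?_
  · intro i k hk
    rw [Pi.add_apply, Pi.add_apply, wsupp_Vap hW0 hWrec u v i k hk, wsupp_Vap hW0 hWrec u v' i k hk, add_zero]
  · funext c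
    rw [toVec_add, Pi.add_apply, toVec_Vap (toVec_Wv hW0 hWrec hP (v + v')) u c,
      toVec_Vap (toVec_Wv hW0 hWrec hP v) u c, toVec_Vap (toVec_Wv hW0 hWrec hP v') u c, ← Finset.sum_add_distrib]
    refine Finset.sum_congr rfl fun n _ => ?_
    rw [toVec_add, varJet_add (Qw cd) (toVec cd (cd.x j s)) (fun a b b' => (isLinearMap_Qw_right cd a).map_add b b')
      (fun a a' b => (isLinearMap_Qw_left cd b).map_add a a')]
    rw [Pi.add_apply]; ring

/-- `Vap` is homogeneous in the vector argument. [folklore] -/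
theorem Vap_smul (u r : ℝ) (v : Fin 4 → ℤ → ℝ) : cd.Vap j s u (r • v) = r • cd.Vap j s u v := by
  refine eq_of_toVec_eq cd (wsupp_Vap hW0 hWrec u _) ?_ ?_
  · intro i k hk
    rw [Pi.smul_apply, Pi.smul_apply, wsupp_Vap hW0 hWrec u v i k hk, smul_zero]
  · funext c
    rw [toVec_smul, Pi.smul_apply, toVec_Vap (toVec_Wv hW0 hWrec hP (r • v)) u c,
      toVec_Vap (toVec_Wv hW0 hWrec hP v) u c, smul_eq_mul, Finset.mul_sum]
    refine Finset.sum_congr rfl fun n _ => ?_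
    rw [toVec_smul, varJet_smul (Qw cd) (toVec cd (cd.x j s)) (fun r a b => (isLinearMap_Qw_right cd a).map_smul r b)
      (fun r a b => (isLinearMap_Qw_left cd b).map_smul r a)]
    rw [Pi.smul_apply, smul_eq_mul]; ring

/-- `Vap 0 = 0`. [folklore] -/
theorem Vap_zero (u : ℝ) : cd.Vap j s u 0 = 0 := by
  have h := Vap_smul hW0 hWrec hP u 0 0
  rwa [zero_smul, zero_smul] at h

/-- `Vap` respects subtraction. [folklore] -/
theorem Vap_sub (u : ℝ) (v v' : Fin 4 → ℤ → ℝ) : cd.Vap j s u (v - v') = cd.Vap j s u v - cd.Vap j s u v' := by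
  rw [sub_eq_add_neg, Vap_add hW0 hWrec hP, ← neg_one_smul ℝ v', Vap_smul hW0 hWrec hP, neg_one_smul,
    sub_eq_add_neg]

omit hP in
/-- `Vap` only sees the window of its vector argument. [folklore] -/
theorem Vap_trunc (u : ℝ) (v : Fin 4 → ℤ → ℝ) : cd.Vap j s u (trunc cd v) = cd.Vap j s u v := by
  -- both sides are the same polynomial of window-supported tables with the same initial truncation
  have h0' : ∀ i k, cd.Wv j s 0 (trunc cd v) i k = cd.Wv j s 0 v i k := by
    intro i k
    rw [hW0, hW0]
    by_cases hk : -cd.Kb ≤ k ∧ k ≤ cd.Ka <;> simp [trunc, hk]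
  have hall : ∀ n, n ≤ cd.pdeg → cd.Wv j s n (trunc cd v) = cd.Wv j s n v := by
    intro n
    induction n using Nat.strong_induction_on with
    | _ n ih =>
      intro hn
      cases n with
      | zero => funext i k; exact h0' i k
      | succ n =>
        funext i k
        have hlt : n < cd.pdeg := Nat.lt_of_succ_le hn
        have h1 := hWrec n hlt (trunc cd v) i k
        have h2 := hWrec n hlt v i k
        have hs : ∑ m' ∈ Finset.range (n + 1), (cd.Qb (cd.P j s m') (cd.Wv j s (n - m') (trunc cd v)) i k +
            cd.Qb (cd.Wv j s (n - m') (trunc cd v)) (cd.P j s m') i k) =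
            ∑ m' ∈ Finset.range (n + 1), (cd.Qb (cd.P j s m') (cd.Wv j s (n - m') v) i k +
            cd.Qb (cd.Wv j s (n - m') v) (cd.P j s m') i k) := by
          refine Finset.sum_congr rfl fun m' _ => ?_
          rw [ih (n - m') (Nat.lt_succ_of_le (Nat.sub_le n m')) ((Nat.sub_le n m').trans hlt.le)]
        rw [hs, ← h2] at h1
        have hk' : ((n : ℝ) + 1) ≠ 0 := by positivity
        exact mul_left_cancel₀ hk' h1
  funext i k
  simp only [CertData.Vap]
  refine Finset.sum_congr rfl fun n hn => ?_
  rw [hall n (Nat.lt_succ_iff.1 (Finset.mem_range.1 hn))]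

end Vap

/-! ### Package flows only see the window of the datum; off-window components vanish -/

/-- Off-window components of a package flow vanish (F0). [folklore] -/
theorem stAt_off_window {φ : Flow} (hF : IsFlowPackage cd φ) {j : ℕ} (hj : j ≤ cd.N₀) (z : Fin 4 → ℤ → ℝ)
    (t : ℝ) : cd.Wsupp (stAt φ j z t) := fun i k hk => (hF j hj).1 z i k hk t

/-- **Window congruence of package flows** (F1 + F2): two data agreeing on the window have the same flow on
every guarded horizon. [folklore] -/
theorem stAt_congr_window {φ : Flow} (hF : IsFlowPackage cd φ) {j : ℕ} (hj : j ≤ cd.N₀) {z z' : Fin 4 → ℤ → ℝ}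
    (hzz : ∀ i k, -cd.Kb ≤ k → k ≤ cd.Ka → z i k = z' i k) {m T : ℝ} (hm : 0 ≤ m) (hz : cd.InBall j z m)
    (hT : 0 ≤ T) (hg : cd.bb j * m * T < 1) {t : ℝ} (ht : t ∈ Icc 0 T) : stAt φ j z t = stAt φ j z' t := by
  obtain ⟨h0, h1, h2, -⟩ := hF j hj
  -- the flow from `z` solves from the window values of `z'`
  have hsol := (h1 z m T hm hz hT hg).1
  have hψ : ∀ i k, -cd.Kb ≤ k → k ≤ cd.Ka → φ j z i k 0 = z' i k ∧ ∀ t' ∈ Icc 0 T,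
      HasDerivWithinAt (φ j z i k)
        (quadTerm 1 cd.α (fun j' n s' => if -cd.Kb ≤ n ∧ n ≤ cd.Ka then φ j z j' n s' else 0) i k t')
        (Icc 0 T) t' := by
    intro i k hk1 hk2
    obtain ⟨a, b⟩ := hsol i k hk1 hk2
    exact ⟨a.trans (hzz i k hk1 hk2), b⟩
  have huniq := h2 z' T (fun i k => φ j z i k) hT hψ
  funext i k
  by_cases hk : -cd.Kb ≤ k ∧ k ≤ cd.Ka
  · exact huniq i k hk.1 hk.2 t ht
  · rw [stAt, stAt, h0 z i k hk t, h0 z' i k hk t]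

end Summit.NavierStokesRegularity.NavierStokesRegularity.Theorems.TaylorModelReadout

end
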